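import Summits.Parity.BatemanHorn.Theses.AlmostPrimeZeros

/-!
# Sketch — first lemmas of three crux ideas for `SystemZeroRepulsion` (stmt-Parity-11291)

Ideator 3, round 1.  Every `def … : Prop` below is the `First lemma:` of one idea card under
`Ideas/`.  Nothing is proved here; the file only has to elaborate (crux-ideate protocol).

* card `rough-profile-descent`   : `TruncatedEulerProduct`, `TruncatedZeroRepulsion`
* card `cone-dominance`          : `ConeDominance`, `ConeSplit`, `OmegaTwinHyperbolicity`
* card `cumulant-radius`         : `CumulantRadiusCriterion`, `SystemCumulantBound`
-/

namespace Summit.Parity.BatemanHorn.Cruxes.SystemZeroRepulsion.Sketch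

open scoped BigOperators
open Polynomial Classical

/-! ## Card A — rough-profile descent -/

/-- Truncation height `y(x) = exp(log x / (log log x)^3)`: all primes below `y` are "small". -/
noncomputable def truncHeight (x : ℕ) : ℝ :=
  Real.exp (Real.log x / (Real.log (Real.log x)) ^ 3)

/-- The `y`-truncated capped statistic `s_{f,y}(n) = Σ_i Σ_{p ≤ y, p^v ∥ f_i(n)} min(v,2)`. -/
noncomputable def truncStat {k : ℕ} (f : Fin k → Polynomial ℤ) (y : ℝ) (n : ℕ) : ℕ :=
  ∑ i, (((f i).eval (n : ℤ)).toNat.factorization.sum fun p v => if (p : ℝ) ≤ y then min v 2 else 0)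

/-- Capped valuation `min(v_p(m), 2)` read off `m mod p²` (so `m = 0 ↦ 2`). -/
noncomputable def capVal (p : ℕ) (m : ℤ) : ℕ :=
  if ((p : ℤ) ^ 2) ∣ m then 2 else if (p : ℤ) ∣ m then 1 else 0

/-- Local factor `E_p(z) = p⁻² Σ_{a mod p²} z^{Σ_i min(v_p(f_i(a)),2)}` of a system at `p`;
`E_p(1) = 1`, `E_p(0) = 1 − ω_f(p)/p` for good `p`, zeros `z_p` with `|1 − z_p|² = p²/ω_f(p)`. -/
noncomputable def localFactor {k : ℕ} (f : Fin k → Polynomial ℤ) (p : ℕ) (z : ℂ) : ℂ :=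
  ((p : ℂ) ^ 2)⁻¹ * ∑ a ∈ Finset.range (p ^ 2), z ^ (∑ i, capVal p ((f i).eval (a : ℤ)))

/-- **Card A, first lemma (complex fundamental lemma along a Bateman–Horn system).**
With `y = exp(log x/(log log x)³)`, uniformly for `‖z‖ ≤ K log log x`:
`Σ_{n ≤ x} z^{s_{f,y}(n)} = (x+1) ∏_{p ≤ y} E_p(z) + O(x·exp(−(log log x)³/4))`
(savings `e^{−u/2}`, `u = (log log x)³`, against losses `e^{O_K((log log x)²)}` — so uniformity in
`‖z‖ ≤ K log log x` is free, and the error stays below `|main term| ≥ x e^{−kK(log log x)² − o(·)}`).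
Provable now (divisor expansion of `z^{s_y}`, CRT level `x^{1−ε}` for polynomial congruences,
binomial-moment Chernoff truncation of `s_y > (log log x)³/4`, Rankin tail); for `f = X` it is
Hall–Tenenbaum 1988 Thm 02 with `f(p) = z (p ≤ y)`. -/
def TruncatedEulerProduct : Prop :=
  ∀ (k : ℕ) (f : Fin k → Polynomial ℤ), Literature.NumberTheory.Sieve.IsBatemanHornSystem f →
    ∀ K : ℝ, 0 < K → ∃ x₀ : ℕ, ∀ x : ℕ, x₀ ≤ x → ∀ z : ℂ, ‖z‖ ≤ K * Real.log (Real.log x) →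
      ‖(∑ n ∈ Finset.range (x + 1), z ^ (truncStat f (truncHeight x) n)) -
          ((x : ℂ) + 1) * ∏ p ∈ Nat.primesBelow (⌊truncHeight x⌋₊ + 1), localFactor f p z‖
        ≤ x * Real.exp (-(Real.log (Real.log x)) ^ 3 / 4)

/-- **Card A, calibration theorem (all systems, provable now from `TruncatedEulerProduct`).**
The almost-prime polynomial of the TRUNCATED statistic repels 1 with an explicit bound:
`limsup_x T(S^{(y)}_x) ≤ 2 Σ_p ω_f(p)/p²` — every Γ-lattice zero and all parity/anatomy content of
`SystemZeroRepulsion` is carried by the ≤ `3k log log log x + O(1)` prime factors above `y`. -/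
def TruncatedZeroRepulsion : Prop :=
  ∀ (k : ℕ) (f : Fin k → Polynomial ℤ), Literature.NumberTheory.Sieve.IsBatemanHornSystem f →
    ∃ C : ℝ, ∀ x : ℕ, 16 ≤ x →
      ((∑ n ∈ Finset.range (x + 1), (X : Polynomial ℂ) ^ (truncStat f (truncHeight x) n)).roots.map
        (fun ρ : ℂ => (‖(1 : ℂ) - ρ‖ ^ 2)⁻¹)).sum ≤ C

/-! ## Card C — cone dominance / hyperbolicity of the ω-twin -/

/-- **Card C, first lemma (termwise cone dominance, provable now).** For a zero `ρ` in the cone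
`|Im ρ| ≤ t (1 − Re ρ)`, `t < 1`:  `|1−ρ|⁻² ≤ (1+t²)/(1−t²) · Re (1−ρ)⁻²`. -/
def ConeDominance : Prop :=
  ∀ (t : ℝ), 0 ≤ t → t < 1 → ∀ ρ : ℂ, 0 < (1 - ρ).re → |ρ.im| ≤ t * (1 - ρ).re →
    (‖(1 : ℂ) - ρ‖ ^ 2)⁻¹ ≤ (1 + t ^ 2) / (1 - t ^ 2) * (((1 : ℂ) - ρ) ^ 2)⁻¹.re

/-- **Card C, summed form.** For every `P ∈ ℂ[z]` with `P(1) ≠ 0`: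
`T(P) ≤ C_t · Σ_ρ Re(1−ρ)⁻² + (1 + C_t) · Σ_{ρ in the wings} |1−ρ|⁻²`, `C_t = (1+t²)/(1−t²)`;
with `P = S_x` the middle sum is the parity-blind moment deficit `m₁ − v` (route item
`SystemMomentDeficit`), so `SystemZeroRepulsion ⟸ SystemMomentDeficit ∧ WingEscapeBound`. -/
def ConeSplit : Prop :=
  ∀ (t : ℝ), 0 ≤ t → t < 1 → ∀ P : Polynomial ℂ, P.eval 1 ≠ 0 →
    (P.roots.map (fun ρ : ℂ => (‖(1 : ℂ) - ρ‖ ^ 2)⁻¹)).sum ≤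
      (1 + t ^ 2) / (1 - t ^ 2) * (P.roots.map (fun ρ : ℂ => ((((1 : ℂ) - ρ) ^ 2)⁻¹).re)).sum
      + (1 + (1 + t ^ 2) / (1 - t ^ 2)) *
        ((P.roots.filter (fun ρ : ℂ => t * (1 - ρ).re < |ρ.im|)).map
          (fun ρ : ℂ => (‖(1 : ℂ) - ρ‖ ^ 2)⁻¹)).sum

/-- `ω(F(n))`, `F = ∏ f_i`: the cap-1 ("ω-twin") statistic of a system. -/
noncomputable def omegaStat {k : ℕ} (f : Fin k → Polynomial ℤ) (n : ℕ) : ℕ :=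
  (∏ i, ((f i).eval (n : ℤ)).toNat).primeFactors.card

/-- **Card C, transfer conjecture (asymptotic hyperbolicity of the ω-twin).** The ω-twin
`P^ω_x(z) = Σ_{n ≤ x} z^{ω(F(n))}` has Laguerre–Pólya limit `λ^ω_F(z) D^{z−1} Γ(z)^{−k}` (all limit
zeros real: `−ℕ ∪ {1 − p/ω_F(p)}`), and its non-hyperbolicity `T − Σ Re(1−ρ)⁻² → 0`. -/
def OmegaTwinHyperbolicity : Prop :=
  ∀ (k : ℕ) (f : Fin k → Polynomial ℤ), Literature.NumberTheory.Sieve.IsBatemanHornSystem f →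
    Filter.Tendsto (fun x : ℕ =>
      ((∑ n ∈ Finset.range (x + 1), (X : Polynomial ℂ) ^ (omegaStat f n)).roots.map
          (fun ρ : ℂ => (‖(1 : ℂ) - ρ‖ ^ 2)⁻¹)).sum
      - ((∑ n ∈ Finset.range (x + 1), (X : Polynomial ℂ) ^ (omegaStat f n)).roots.map
          (fun ρ : ℂ => ((((1 : ℂ) - ρ) ^ 2)⁻¹).re)).sum)
      Filter.atTop (nhds 0)

/-! ## Card B — cumulant radius -/

/-- **Card B, first lemma (Cauchy–Hadamard / cumulant-radius criterion, provable now).**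
If the cumulants `κ_r = K^{(r)}(0)` of the law `(c_j)` (mgf `Σ c_j e^{jt}`, cgf `K = log mgf`)
satisfy `|κ_r| ≤ A·B^r·r!` for `r ≥ 2`, then `Σ c_j z^j ≠ 0` whenever `|log z| < 1/B`. -/
def CumulantRadiusCriterion : Prop :=
  ∀ (N : ℕ) (c : ℕ → ℕ) (A B : ℝ), 0 < B → (∑ j ∈ Finset.range (N + 1), c j) ≠ 0 →
    (∀ r : ℕ, 2 ≤ r →
      |iteratedDeriv r (fun t : ℝ =>
          Real.log (∑ j ∈ Finset.range (N + 1), (c j : ℝ) * Real.exp (j * t))) 0|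
        ≤ A * B ^ r * r.factorial) →
    ∀ z : ℂ, z ≠ 0 → ‖Complex.log z‖ < B⁻¹ →
      (∑ j ∈ Finset.range (N + 1), (c j : ℂ) * z ^ j) ≠ 0

/-- The route's capped statistic `s_f(n) = Σ_i Σ_{p^v ∥ f_i(n)} min(v,2)` (verbatim sub-term of
`SystemZeroRepulsion`). -/
noncomputable def capStat {k : ℕ} (f : Fin k → Polynomial ℤ) (n : ℕ) : ℕ :=
  ∑ i, (((f i).eval (n : ℤ)).toNat.factorization.sum fun _ v => min v 2)

/-- The empirical cumulant `κ_r(x)` of `s_f(U_x)`, `U_x` uniform on `{0,…,x}`. -/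
noncomputable def empCumulant {k : ℕ} (f : Fin k → Polynomial ℤ) (x r : ℕ) : ℝ :=
  iteratedDeriv r (fun t : ℝ => Real.log (((x : ℝ) + 1)⁻¹ *
    ∑ n ∈ Finset.range (x + 1), Real.exp (t * (capStat f n : ℝ)))) 0

/-- **Card B, transfer target (uniform factorial cumulant bound = zero-free region
`|log z| < 1/B` for every `x`, by `CumulantRadiusCriterion`).** The order-2 case
`κ₁ − κ₂ = m₁ − v = O(1)` is the route's `SystemMomentDeficit`; necessarily `B ≥ 1/π`
(the zero near `z = −1`); `∃ x₀` (not `∀ x ≥ 16`) because of the disprover's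
`exists_system_root_near_one` (roots within ε of 1 at small x for suitable systems). -/
def SystemCumulantBound : Prop :=
  ∀ (k : ℕ) (f : Fin k → Polynomial ℤ), Literature.NumberTheory.Sieve.IsBatemanHornSystem f →
    ∃ A B : ℝ, ∃ x₀ : ℕ, 0 < B ∧ B < 1 ∧ ∀ x : ℕ, x₀ ≤ x → ∀ r : ℕ, 2 ≤ r →
      |empCumulant f x r| ≤ A * Real.log (Real.log x) + A * B ^ r * r.factorial

end Summit.Parity.BatemanHorn.Cruxes.SystemZeroRepulsion.Sketch
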